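import Literature.MathematicalPhysics.QuantumLattice.LiebRobinsonProofs
import Literature.MathematicalPhysics.QuantumLattice.FermionTraceFactorization
import Literature.MathematicalPhysics.QuantumLattice.HubbardGaugeBound
import HarnessLib

/-!
# Lieb–Robinson bounds in series form, and the Lieb–Robinson bound for lattice fermions
# (the Hubbard Hamiltonian on a finite graph)

Trunk T-QLATTICE, family `hubbard`. Groundwork for the many-body index theorem of
Bachmann–Bols–De Roeck–Fraas behind the named fact `bbdf2019_lsm_filling_hubbardTorus`
(`HubbardLSMFilling.lean`): BBDF's Proposition 2.4 (gapped ground state ⇒ local charge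
fluctuations and clustering) rests on Lieb–Robinson bounds for LATTICE FERMIONS with even
interactions (BBDF §2.1.4: "the Heisenberg dynamics … satisfies a Lieb–Robinson bound … the main
reasons why `𝒜` is chosen to be the even algebra in the fermionic case"). The tree's Lieb–Robinson
statements (`LiebRobinson.lean`, `lieb_robinson`) concern quantum SPIN systems (`Op Λ q`, tensor
locality). This file PROVES:

* `lieb_robinson_abstract` — an abstract Lieb–Robinson bound for an arbitrary finite sum
  `H = Σ_Z h_Z` of Hermitian matrices, from three pieces of combinatorial data: a relation
  `touch` outside of which terms commute, a level function `ℓ` (distance of a term to the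
  support of `B`: `[h_Z, B] = 0` off level `0`, `ℓ` drops by `≤ 1` along touching terms) and a
  set `S` of terms outside of which everything commutes with `A`; with `‖h_Z‖ ≤ J` and `≤ D`
  terms touching a term: for `t ≥ 0`,
  `‖[τ_t(A), B]‖ ≤ ‖[A, B]‖ + 2‖A‖ Σ_{Z ∈ S} 2J‖B‖ t e^{2eJD t − ℓ(Z)}`.
  Architecture = Hastings–Koma, App. A: the Duhamel / interaction-picture inequality (taken from
  the tree, `norm_comm_heisenbergEvolution_le` of `LiebRobinsonIntegralProofs`, via `LiebRobinsonProofs`), applied to `A`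
  and to every `h_Z`, gives a closed finite system of integral inequalities (HK eq. (A.8)); it is
  iterated `N` times (`gronwall_iterate`: `u ≤ Σ_{n<N} tⁿ/n! Kⁿb + t^N/N! K^N M`, a vector-valued
  Grönwall iteration with the trivial a-priori bound `M = 2‖h_Z‖‖B‖`), the remainder tends to `0`,
  short chains vanish (`iterKernel_eq_zero_of_lt`, the light cone) and the tail of the
  exponential series is `Σ_{n ≥ ℓ} xⁿ/n! ≤ e^{-ℓ} e^{ex}`.
* `fermion_lieb_robinson_hamiltonianWith` — **the Lieb–Robinson bound for the Hubbard model
  `H(t,U) − μN` on any finite graph of maximal degree `≤ Δ`** (Jordan–Wigner matrices of the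
  tree), for `A` in the CAR algebra of the sites `X` and `B` in that of `Y`
  (`FermionTraceFactorization.carSubalgebra`), and any `δ : Λ → ℕ` vanishing on `Y` and
  `1`-Lipschitz along edges (e.g. the graph distance to `Y`): `H` is written as the sum
  (`sum_hubbardTermOp`) of the even, Hermitian local terms `hubbardTermOp` (symmetrised hopping
  on ordered bonds, on-site `U n↑n↓ − μn`), whose graded locality is
  `commute_of_mem_carEvenSubalgebra` (Bratteli–Robinson II §5.2.2); `J = 2|t| + |U| + 2|μ|`,
  `D = 2(2Δ+1)`, and the `≤ |X|(2Δ+1)` terms meeting `X` have level `≥ min_X δ − 1`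
  (`card_filter_not_disjoint_hubbardTermSupp_le`).

No named fact is introduced; definitions (`iterKernel`, `gronwallPoly`, `orbSet`, `HubbardIdx`,
`hubbardTermOp`, `hubbardTermSupp`) have bodies and proved API.

## References

* M. B. Hastings, T. Koma, *Spectral gap and exponential decay of correlations*, CMP 265 (2006)
  781–804, arXiv:math-ph/0507008, Appendix A "the Lieb–Robinson bound … for quantum spin or
  fermion systems": eq. (A.7) (`‖[A(t),B]‖ − ‖[A(0),B]‖ ≤ 2‖A‖ Σ_{Z∩X≠∅} ∫₀^{|t|} ‖[h_Z(s),B]‖`),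
  (A.8) (`C_B(X,t) ≤ C_B(X,0) + 2Σ‖h_Z‖∫C_B(Z,s)`), its iteration (A.9)–(A.10), and Thm. 17
  (finite-range / exponentially decaying interactions). [HastingsKoma2006]
* B. Nachtergaele, R. Sims, CMP 265 (2006) 119–130, Thm. 1 and its proof (§3.1).
  [NachtergaeleSims2006]
* O. Bratteli, D. W. Robinson, *Operator Algebras and QSM II*, §5.2.2 (even elements of the CAR
  algebras of disjoint regions commute). [BratteliRobinsonII1997]
* S. Bachmann, A. Bols, W. De Roeck, M. Fraas, CMP 375 (2019) 1249, §2.1.4 and Prop. 2.4 (where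
  the fermionic Lieb–Robinson bound enters). [BachmannEtAl2019]
-/

noncomputable section

open Matrix Complex Finset
open scoped Matrix.Norms.L2Operator

namespace Literature.MathematicalPhysics.QuantumLattice

/-! ### A vector-valued Gronwall iteration (the Lieb–Robinson series) -/

section Gronwall

variable {ι : Type*} [Fintype ι]

/-- Iterates of a kernel on a vector: `iterKernel K b 0 = b`,
`iterKernel K b (n+1) Z = Σ_{Z'} K Z Z' · iterKernel K b n Z'` (the `n`-th term `(Kⁿ b)_Z` of the
Lieb–Robinson series, a sum over chains `Z → Z₁ → ⋯ → Z_n`). [folklore] -/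
def iterKernel (K : ι → ι → ℝ) (b : ι → ℝ) : ℕ → ι → ℝ
  | 0 => b
  | n + 1 => fun Z => ∑ Z', K Z Z' * iterKernel K b n Z'

/-- `(K⁰ b) = b`. [folklore] -/
@[simp] theorem iterKernel_zero (K : ι → ι → ℝ) (b : ι → ℝ) : iterKernel K b 0 = b := rfl

/-- `(Kⁿ⁺¹ b)_Z = Σ_{Z'} K Z Z' (Kⁿ b)_{Z'}`. [folklore] -/
theorem iterKernel_succ (K : ι → ι → ℝ) (b : ι → ℝ) (n : ℕ) (Z : ι) :
    iterKernel K b (n + 1) Z = ∑ Z', K Z Z' * iterKernel K b n Z' := rfl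

/-- The iterates of a nonnegative kernel on a nonnegative vector are nonnegative. [folklore] -/
theorem iterKernel_nonneg {K : ι → ι → ℝ} {b : ι → ℝ} (hK : ∀ Z Z', 0 ≤ K Z Z')
    (hb : ∀ Z, 0 ≤ b Z) : ∀ n Z, 0 ≤ iterKernel K b n Z
  | 0, Z => hb Z
  | n + 1, Z => Finset.sum_nonneg fun Z' _ => mul_nonneg (hK Z Z') (iterKernel_nonneg hK hb n Z')

/-- The iterates are monotone in the vector (nonnegative kernel). [folklore] -/
theorem iterKernel_mono {K : ι → ι → ℝ} {b b' : ι → ℝ} (hK : ∀ Z Z', 0 ≤ K Z Z')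
    (hbb' : ∀ Z, b Z ≤ b' Z) : ∀ n Z, iterKernel K b n Z ≤ iterKernel K b' n Z
  | 0, Z => hbb' Z
  | n + 1, Z => Finset.sum_le_sum fun Z' _ =>
      mul_le_mul_of_nonneg_left (iterKernel_mono hK hbb' n Z') (hK Z Z')

/-- Row-sum bound: if `Σ_{Z'} K Z Z' ≤ κ` and `b ≤ β` then `(Kⁿ b)_Z ≤ κⁿ β`. [folklore] -/
theorem iterKernel_le_pow {K : ι → ι → ℝ} {b : ι → ℝ} {κ β : ℝ} (hK : ∀ Z Z', 0 ≤ K Z Z')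
    (hκ : ∀ Z, ∑ Z', K Z Z' ≤ κ) (hβ : 0 ≤ β) (hb : ∀ Z, b Z ≤ β) :
    ∀ n Z, iterKernel K b n Z ≤ κ ^ n * β
  | 0, Z => by simpa using hb Z
  | n + 1, Z => by
    have hκ0 : 0 ≤ κ := le_trans (Finset.sum_nonneg fun Z' _ => hK Z Z') (hκ Z)
    calc iterKernel K b (n + 1) Z = ∑ Z', K Z Z' * iterKernel K b n Z' := rfl
      _ ≤ ∑ Z', K Z Z' * (κ ^ n * β) :=
          Finset.sum_le_sum fun Z' _ => mul_le_mul_of_nonneg_left (iterKernel_le_pow hK hκ hβ hb n Z') (hK Z Z')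
      _ = (∑ Z', K Z Z') * (κ ^ n * β) := by rw [Finset.sum_mul]
      _ ≤ κ * (κ ^ n * β) := mul_le_mul_of_nonneg_right (hκ Z) (by positivity)
      _ = κ ^ (n + 1) * β := by ring

/-- The polynomial majorant of the Gronwall iteration:
`G_N(s)_Z = Σ_{n<N} sⁿ/n! (Kⁿ b)_Z + s^N/N! (K^N M)_Z`. [folklore] -/
def gronwallPoly (K : ι → ι → ℝ) (b M : ι → ℝ) (N : ℕ) (Z : ι) (s : ℝ) : ℝ :=
  (∑ n ∈ Finset.range N, s ^ n / n.factorial * iterKernel K b n Z) +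
    s ^ N / N.factorial * iterKernel K M N Z

/-- The majorant is continuous in `s`. [folklore] -/
theorem continuous_gronwallPoly (K : ι → ι → ℝ) (b M : ι → ℝ) (N : ℕ) (Z : ι) :
    Continuous (gronwallPoly K b M N Z) := by
  unfold gronwallPoly
  fun_prop

/-- Integrating the majorant raises the degree:
`b_Z + Σ_{Z'} K Z Z' ∫₀ˢ G_N(r)_{Z'} dr = G_{N+1}(s)_Z`. [folklore] -/
theorem integral_gronwallPoly (K : ι → ι → ℝ) (b M : ι → ℝ) (N : ℕ) (Z : ι) (s : ℝ) :
    b Z + ∑ Z', K Z Z' * ∫ r in (0 : ℝ)..s, gronwallPoly K b M N Z' r =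
      gronwallPoly K b M (N + 1) Z s := by
  have hint : ∀ Z', ∫ r in (0 : ℝ)..s, gronwallPoly K b M N Z' r =
      (∑ n ∈ Finset.range N, s ^ (n + 1) / (n + 1).factorial * iterKernel K b n Z') +
        s ^ (N + 1) / (N + 1).factorial * iterKernel K M N Z' := by
    intro Z'
    have hc1 : Continuous fun r : ℝ =>
        ∑ n ∈ Finset.range N, r ^ n / n.factorial * iterKernel K b n Z' := by fun_prop
    have hc2 : Continuous fun r : ℝ => r ^ N / N.factorial * iterKernel K M N Z' := by fun_prop
    have hc3 : ∀ n : ℕ, Continuous fun r : ℝ => r ^ n / n.factorial * iterKernel K b n Z' :=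
      fun n => by fun_prop
    unfold gronwallPoly
    rw [intervalIntegral.integral_add (hc1.intervalIntegrable _ _) (hc2.intervalIntegrable _ _),
      intervalIntegral.integral_finsetSum fun n _ => (hc3 n).intervalIntegrable _ _]
    congr 1
    · refine Finset.sum_congr rfl fun n _ => ?_
      rw [intervalIntegral.integral_mul_const, intervalIntegral.integral_div, integral_pow]
      rw [Nat.factorial_succ]
      push_cast
      field_simp
      ring
    · rw [intervalIntegral.integral_mul_const, intervalIntegral.integral_div, integral_pow]
      rw [Nat.factorial_succ]
      push_cast
      field_simp
      ring
  simp_rw [hint]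
  unfold gronwallPoly
  rw [Finset.sum_range_succ', pow_zero, Nat.factorial_zero, Nat.cast_one, div_one, one_mul,
    iterKernel_zero]
  simp only [mul_add, Finset.mul_sum, Finset.sum_add_distrib]
  rw [Finset.sum_comm]
  have h1 : ∀ n ∈ Finset.range N, ∑ Z', K Z Z' * (s ^ (n + 1) / (n + 1).factorial * iterKernel K b n Z') =
      s ^ (n + 1) / (n + 1).factorial * iterKernel K b (n + 1) Z := by
    intro n _
    rw [iterKernel_succ, Finset.mul_sum]
    refine Finset.sum_congr rfl fun Z' _ => ?_
    ring
  have h2 : ∑ Z', K Z Z' * (s ^ (N + 1) / (N + 1).factorial * iterKernel K M N Z') =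
      s ^ (N + 1) / (N + 1).factorial * iterKernel K M (N + 1) Z := by
    rw [iterKernel_succ, Finset.mul_sum]
    refine Finset.sum_congr rfl fun Z' _ => ?_
    ring
  rw [Finset.sum_congr rfl h1, h2]
  ring

/-- **Vector-valued Gronwall iteration.** Let `K ≥ 0` be a kernel on a finite index set, `u_Z`
continuous functions with the a priori bound `u_Z ≤ M_Z` on `[0, t]` and the integral inequalities
`u_Z(s) ≤ b_Z + Σ_{Z'} K Z Z' ∫₀ˢ u_{Z'}` on `[0, t]`. Then for every `N`,
`u_Z(s) ≤ Σ_{n<N} sⁿ/n! (Kⁿ b)_Z + s^N/N! (K^N M)_Z` on `[0, t]` (iterate the inequality `N` times).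
This is the iteration behind the Lieb–Robinson series; Hastings–Koma, CMP 265 (2006) 781, App. A
(iteration of eq. (A.8)); Nachtergaele–Sims, CMP 265 (2006) 119, proof of Thm. 1. [folklore] -/
theorem gronwall_iterate {K : ι → ι → ℝ} {b M : ι → ℝ} {u : ι → ℝ → ℝ} {t : ℝ}
    (hK : ∀ Z Z', 0 ≤ K Z Z') (hu : ∀ Z, Continuous (u Z))
    (hM : ∀ Z, ∀ s ∈ Set.Icc 0 t, u Z s ≤ M Z)
    (hineq : ∀ Z, ∀ s ∈ Set.Icc 0 t, u Z s ≤ b Z + ∑ Z', K Z Z' * ∫ r in (0 : ℝ)..s, u Z' r) :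
    ∀ (N : ℕ) (Z : ι), ∀ s ∈ Set.Icc 0 t, u Z s ≤ gronwallPoly K b M N Z s := by
  intro N
  induction N with
  | zero =>
    intro Z s hs
    simpa [gronwallPoly] using hM Z s hs
  | succ N ih =>
    intro Z s hs
    have hs0 : 0 ≤ s := hs.1
    refine (hineq Z s hs).trans ?_
    rw [← integral_gronwallPoly]
    refine add_le_add le_rfl (Finset.sum_le_sum fun Z' _ => mul_le_mul_of_nonneg_left ?_ (hK Z Z'))
    refine intervalIntegral.integral_mono_on hs0 ((hu Z').intervalIntegrable _ _)
      ((continuous_gronwallPoly K b M N Z').intervalIntegrable _ _) fun r hr => ?_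
    exact ih Z' r ⟨hr.1, hr.2.trans hs.2⟩

/-- The remainder of the Gronwall iteration tends to zero: if the row sums of `K` are `≤ κ` and
`M ≤ β` then `s^N/N! (K^N M)_Z ≤ (κ s)^N/N! β → 0`. Consequently any `N`-independent bound
`F` of the partial sums bounds `u`: `u_Z(s) ≤ F`. [folklore] -/
theorem le_of_gronwall_iterate {K : ι → ι → ℝ} {b M : ι → ℝ} {u : ι → ℝ → ℝ} {t κ β F : ℝ}
    (hK : ∀ Z Z', 0 ≤ K Z Z') (hu : ∀ Z, Continuous (u Z))
    (hM : ∀ Z, ∀ s ∈ Set.Icc 0 t, u Z s ≤ M Z)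
    (hineq : ∀ Z, ∀ s ∈ Set.Icc 0 t, u Z s ≤ b Z + ∑ Z', K Z Z' * ∫ r in (0 : ℝ)..s, u Z' r)
    (hκ : ∀ Z, ∑ Z', K Z Z' ≤ κ) (hβ : 0 ≤ β) (hMβ : ∀ Z, M Z ≤ β) {Z : ι} {s : ℝ}
    (hs : s ∈ Set.Icc 0 t)
    (hF : ∀ N, (∑ n ∈ Finset.range N, s ^ n / n.factorial * iterKernel K b n Z) ≤ F) :
    u Z s ≤ F := by
  have hκ0 : 0 ≤ κ := by
    obtain ⟨Z₀⟩ : Nonempty ι := ⟨Z⟩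
    exact le_trans (Finset.sum_nonneg fun Z' _ => hK Z₀ Z') (hκ Z₀)
  -- `u ≤ F + (κ s)^N / N! β` for all `N`
  have hN : ∀ N : ℕ, u Z s ≤ F + (κ * s) ^ N / N.factorial * β := by
    intro N
    refine (gronwall_iterate hK hu hM hineq N Z s hs).trans ?_
    unfold gronwallPoly
    refine add_le_add (hF N) ?_
    calc s ^ N / N.factorial * iterKernel K M N Z ≤ s ^ N / N.factorial * (κ ^ N * β) :=
          mul_le_mul_of_nonneg_left (iterKernel_le_pow hK hκ hβ hMβ N Z) (by have := hs.1; positivity)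
      _ = (κ * s) ^ N / N.factorial * β := by rw [mul_pow]; ring
  -- the remainder tends to zero
  have hlim : Filter.Tendsto (fun N : ℕ => F + (κ * s) ^ N / N.factorial * β) Filter.atTop
      (nhds (F + 0 * β)) :=
    ((FloorSemiring.tendsto_pow_div_factorial_atTop (κ * s)).mul_const β).const_add F
  rw [zero_mul, add_zero] at hlim
  exact ge_of_tendsto' hlim hN

end Gronwall


/-! ### Elementary lemmas on commutators and the evolution -/

section EvolutionLemmas

variable {n : Type*} [Fintype n] [DecidableEq n]

/-- The Heisenberg evolution is continuous in time (the propagators `u ↦ e^{uK}` are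
differentiable, `hasDerivAt_exp_smul_left` of `LiebRobinsonIntegralProofs`). [folklore] -/
theorem heisenbergEvolution_continuous (H A : Matrix n n ℂ) :
    Continuous fun s : ℝ => heisenbergEvolution H s A := by
  have h1 : Continuous fun u : ℝ => NormedSpace.exp (u • (I • H)) :=
    continuous_iff_continuousAt.2 fun u => (hasDerivAt_exp_smul_left (I • H) u).continuousAt
  have h2 : Continuous fun u : ℝ => NormedSpace.exp (u • (-(I • H))) :=
    continuous_iff_continuousAt.2 fun u => (hasDerivAt_exp_smul_left (-(I • H)) u).continuousAt
  have : (fun s : ℝ => heisenbergEvolution H s A) = fun s : ℝ =>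
      NormedSpace.exp (s • (I • H)) * A * NormedSpace.exp (s • (-(I • H))) :=
    funext fun s => heisenbergEvolution_eq_exp_smul H s A
  rw [this]
  exact (h1.mul continuous_const).mul h2

/-- The Heisenberg evolution is additive over finite sums of observables. [folklore] -/
theorem heisenbergEvolution_finset_sum {ι : Type*} (H : Matrix n n ℂ) (t : ℝ) (s : Finset ι)
    (f : ι → Matrix n n ℂ) :
    heisenbergEvolution H t (∑ i ∈ s, f i) = ∑ i ∈ s, heisenbergEvolution H t (f i) := by
  simp only [heisenbergEvolution, Finset.mul_sum, Finset.sum_mul]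

omit [DecidableEq n] in
/-- The commutator with a finite sum. [folklore] -/
theorem finset_sum_commutator {ι : Type*} (s : Finset ι) (f : ι → Matrix n n ℂ) (B : Matrix n n ℂ) :
    (∑ i ∈ s, f i) * B - B * ∑ i ∈ s, f i = ∑ i ∈ s, (f i * B - B * f i) := by
  rw [Finset.sum_mul, Finset.mul_sum, ← Finset.sum_sub_distrib]

/-- `‖[τ_s(A), B]‖ ≤ 2 ‖A‖ ‖B‖` (the evolution is isometric). [folklore] -/
theorem norm_commutator_heisenbergEvolution_le_two_mul {H : Matrix n n ℂ} (hH : H.IsHermitian)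
    (s : ℝ) (A B : Matrix n n ℂ) :
    ‖heisenbergEvolution H s A * B - B * heisenbergEvolution H s A‖ ≤ 2 * ‖A‖ * ‖B‖ := by
  have h := norm_commutator_le (heisenbergEvolution H s A) B
  rwa [norm_heisenbergEvolution_holds hH] at h

omit [Fintype n] [DecidableEq n] in
/-- A finite sum of Hermitian matrices is Hermitian. [folklore] -/
theorem isHermitian_finset_sum {ι : Type*} (s : Finset ι) {f : ι → Matrix n n ℂ}
    (hf : ∀ i ∈ s, (f i).IsHermitian) : (∑ i ∈ s, f i).IsHermitian := by
  rw [Matrix.IsHermitian, Matrix.conjTranspose_sum]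
  exact Finset.sum_congr rfl fun i hi => (hf i hi).eq

end EvolutionLemmas

/-! ### The abstract Lieb–Robinson bound for sums of local terms -/

section AbstractLR

variable {n : Type*} [Fintype n] [DecidableEq n] {ι : Type*} [Fintype ι]

/-- Integral of the Gronwall majorant: `∫₀ˢ G_N(r)_Z dr = Σ_{n<N} s^{n+1}/(n+1)! (Kⁿ b)_Z +
s^{N+1}/(N+1)! (K^N M)_Z`. [folklore] -/
theorem integral_gronwallPoly_eq (K : ι → ι → ℝ) (b M : ι → ℝ) (N : ℕ) (Z : ι) (s : ℝ) :
    ∫ r in (0 : ℝ)..s, gronwallPoly K b M N Z r =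
      (∑ n ∈ Finset.range N, s ^ (n + 1) / (n + 1).factorial * iterKernel K b n Z) +
        s ^ (N + 1) / (N + 1).factorial * iterKernel K M N Z := by
  have hc1 : Continuous fun r : ℝ =>
      ∑ n ∈ Finset.range N, r ^ n / n.factorial * iterKernel K b n Z := by fun_prop
  have hc2 : Continuous fun r : ℝ => r ^ N / N.factorial * iterKernel K M N Z := by fun_prop
  have hc3 : ∀ n : ℕ, Continuous fun r : ℝ => r ^ n / n.factorial * iterKernel K b n Z :=
    fun n => by fun_prop
  unfold gronwallPoly
  rw [intervalIntegral.integral_add (hc1.intervalIntegrable _ _) (hc2.intervalIntegrable _ _),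
    intervalIntegral.integral_finsetSum fun n _ => (hc3 n).intervalIntegrable _ _]
  congr 1
  · refine Finset.sum_congr rfl fun n _ => ?_
    rw [intervalIntegral.integral_mul_const, intervalIntegral.integral_div, integral_pow]
    rw [Nat.factorial_succ]
    push_cast
    field_simp
    ring
  · rw [intervalIntegral.integral_mul_const, intervalIntegral.integral_div, integral_pow]
    rw [Nat.factorial_succ]
    push_cast
    field_simp
    ring

/-- **Vanishing of short chains.** If the source vector vanishes outside level `0`
(`b_Z = 0` unless `ℓ Z = 0`) and the kernel lowers the level by at most one
(`K Z Z' ≠ 0 → ℓ Z ≤ ℓ Z' + 1`), then `(Kⁿ b)_Z = 0` for `n < ℓ Z`: no chain of `n` steps reaches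
level `0`. (Lieb–Robinson light cone: the commutator series starts at order `dist(X, Y)`.)
[folklore] -/
theorem iterKernel_eq_zero_of_lt {K : ι → ι → ℝ} {b : ι → ℝ} {ℓ : ι → ℕ}
    (hb : ∀ Z, ℓ Z ≠ 0 → b Z = 0) (hK : ∀ Z Z', K Z Z' ≠ 0 → ℓ Z ≤ ℓ Z' + 1) :
    ∀ (m : ℕ) (Z : ι), m < ℓ Z → iterKernel K b m Z = 0
  | 0, Z, h => hb Z (by omega)
  | m + 1, Z, h => by
    rw [iterKernel_succ]
    refine Finset.sum_eq_zero fun Z' _ => ?_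
    by_cases hKZ : K Z Z' = 0
    · rw [hKZ, zero_mul]
    · rw [iterKernel_eq_zero_of_lt hb hK m Z' (by have := hK Z Z' hKZ; omega), mul_zero]

/-- Tail of the exponential series with a light-cone shift:
`Σ_{L ≤ n < N} xⁿ/n! ≤ e^{-L} e^{e x}` for `x ≥ 0` (`xⁿ/n! = e^{-n} (ex)ⁿ/n!`). [folklore] -/
theorem sum_range_filter_pow_div_factorial_le {x : ℝ} (hx : 0 ≤ x) (L N : ℕ) :
    (∑ n ∈ (Finset.range N).filter (fun n => L ≤ n), x ^ n / n.factorial) ≤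
      Real.exp (-L) * Real.exp (Real.exp 1 * x) := by
  have hterm : ∀ n, L ≤ n → x ^ n / n.factorial ≤
      Real.exp (-L) * ((Real.exp 1 * x) ^ n / n.factorial) := by
    intro n hn
    have h1 : (1 : ℝ) ≤ Real.exp (-L) * Real.exp 1 ^ n := by
      rw [Real.exp_one_pow, ← Real.exp_add]
      exact Real.one_le_exp (by have : (L : ℝ) ≤ n := (by exact_mod_cast hn); linarith)
    calc x ^ n / n.factorial = 1 * (x ^ n / n.factorial) := (one_mul _).symm
      _ ≤ Real.exp (-L) * Real.exp 1 ^ n * (x ^ n / n.factorial) :=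
          mul_le_mul_of_nonneg_right h1 (by positivity)
      _ = Real.exp (-L) * ((Real.exp 1 * x) ^ n / n.factorial) := by rw [mul_pow]; ring
  calc (∑ n ∈ (Finset.range N).filter (fun n => L ≤ n), x ^ n / n.factorial)
      ≤ ∑ n ∈ (Finset.range N).filter (fun n => L ≤ n),
          Real.exp (-L) * ((Real.exp 1 * x) ^ n / n.factorial) :=
        Finset.sum_le_sum fun n hn => hterm n (Finset.mem_filter.1 hn).2
    _ ≤ ∑ n ∈ Finset.range N, Real.exp (-L) * ((Real.exp 1 * x) ^ n / n.factorial) :=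
        Finset.sum_le_sum_of_subset_of_nonneg (Finset.filter_subset _ _)
          fun n _ _ => by positivity
    _ = Real.exp (-L) * ∑ n ∈ Finset.range N, (Real.exp 1 * x) ^ n / n.factorial := by
        rw [Finset.mul_sum]
    _ ≤ Real.exp (-L) * Real.exp (Real.exp 1 * x) :=
        mul_le_mul_of_nonneg_left (Real.sum_le_exp_of_nonneg (by positivity) N) (by positivity)

/-- **Abstract Lieb–Robinson bound** (Hastings–Koma / Nachtergaele–Sims, for an arbitrary finite
sum `H = Σ_Z h_Z` of Hermitian terms). Data: a relation `touch` such that non-touching terms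
commute, `‖h_Z‖ ≤ J`, at most `D` terms touch any given term, a "level" `ℓ` (distance of a term to
the support of `B`) with `[h_Z, B] = 0` off level `0` and `ℓ` dropping by at most one along touching
terms, and a set `S` of terms outside of which everything commutes with `A`. Then for `t ≥ 0`
`‖[τ_t(A), B]‖ ≤ ‖[A, B]‖ + 2‖A‖ Σ_{Z ∈ S} 2J‖B‖ t e^{2eJD t - ℓ(Z)}`:
the Duhamel bound (`norm_commutator_heisenbergEvolution_le`) for `A` and for every `h_Z`, the
Gronwall iteration (`gronwall_iterate`), the light cone (`iterKernel_eq_zero_of_lt`) and the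
exponential tail. Hastings–Koma, CMP 265 (2006) 781, App. A (eqs. (A.7)–(A.10)); Nachtergaele–Sims,
CMP 265 (2006) 119, Thm. 1; Lieb–Robinson, CMP 28 (1972) 251.
[cite: HastingsKoma2006, App. A] -/
theorem lieb_robinson_abstract (h : ι → Matrix n n ℂ) (hh : ∀ Z, (h Z).IsHermitian)
    (touch : ι → ι → Prop) [DecidableRel touch]
    (htouch : ∀ Z Z', ¬ touch Z' Z → Commute (h Z') (h Z))
    {J : ℝ} (hJ0 : 0 ≤ J) (hJ : ∀ Z, ‖h Z‖ ≤ J) {D : ℕ}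
    (hD : ∀ Z, (Finset.univ.filter fun Z' => touch Z' Z).card ≤ D)
    (B : Matrix n n ℂ) (ℓ : ι → ℕ) (hℓ0 : ∀ Z, ℓ Z ≠ 0 → Commute (h Z) B)
    (hℓ : ∀ Z Z', touch Z' Z → ℓ Z ≤ ℓ Z' + 1)
    (A : Matrix n n ℂ) (S : Finset ι) (hS : ∀ Z ∉ S, Commute (h Z) A)
    {t : ℝ} (ht : 0 ≤ t) :
    ‖heisenbergEvolution (∑ Z, h Z) t A * B - B * heisenbergEvolution (∑ Z, h Z) t A‖ ≤
      ‖A * B - B * A‖ + 2 * ‖A‖ * ∑ Z ∈ S,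
        2 * J * ‖B‖ * t * Real.exp (Real.exp 1 * (2 * J * D) * t - ℓ Z) := by
  classical
  set H : Matrix n n ℂ := ∑ Z, h Z with hHdef
  have hH : H.IsHermitian := isHermitian_finset_sum _ fun Z _ => hh Z
  -- the functions `u_Z(r) = ‖[τ_r(h_Z), B]‖` are continuous
  have hcont : ∀ X : Matrix n n ℂ, Continuous fun r : ℝ =>
      ‖heisenbergEvolution H r X * B - B * heisenbergEvolution H r X‖ := fun X => by
    have := heisenbergEvolution_continuous H X
    fun_prop
  -- Step 1: the Duhamel bound for an observable commuting with the terms outside `S'`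
  have duhamel : ∀ (A' : Matrix n n ℂ) (S' : Finset ι), (∀ Z ∉ S', Commute (h Z) A') →
      ∀ s : ℝ, 0 ≤ s → ‖heisenbergEvolution H s A' * B - B * heisenbergEvolution H s A'‖ ≤
        ‖A' * B - B * A'‖ + 2 * ‖A'‖ * ∑ Z ∈ S', ∫ r in (0 : ℝ)..s,
          ‖heisenbergEvolution H r (h Z) * B - B * heisenbergEvolution H r (h Z)‖ := by
    intro A' S' hS' s hs
    set P : Matrix n n ℂ := ∑ Z ∈ S', h Z with hPdef
    have hP : P.IsHermitian := isHermitian_finset_sum _ fun Z _ => hh Z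
    have hHP : H - P = ∑ Z ∈ S'ᶜ, h Z := by
      rw [hHdef, hPdef, ← Finset.sum_compl_add_sum S', add_sub_cancel_right]
    have hcomm : Commute (H - P) A' := by
      rw [hHP]
      exact Commute.sum_left _ _ _ fun Z hZ => hS' Z (Finset.mem_compl.1 hZ)
    -- the Duhamel / interaction-picture bound of the tree (`LiebRobinsonIntegralProofs`)
    have hd := norm_comm_heisenbergEvolution_le hH (hH.sub hP) hcomm B s
    rw [sub_sub_cancel, abs_of_nonneg (intervalIntegral.integral_nonneg hs fun r _ => norm_nonneg _)]
      at hd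
    refine hd.trans ?_
    refine add_le_add le_rfl (mul_le_mul_of_nonneg_left ?_ (by positivity))
    have hpt : ∀ r, ‖heisenbergEvolution H r P * B - B * heisenbergEvolution H r P‖ ≤
        ∑ Z ∈ S', ‖heisenbergEvolution H r (h Z) * B - B * heisenbergEvolution H r (h Z)‖ := by
      intro r
      rw [hPdef, heisenbergEvolution_finset_sum, finset_sum_commutator]
      exact norm_sum_le _ _
    rw [← intervalIntegral.integral_finsetSum fun Z _ => (hcont (h Z)).intervalIntegrable _ _]
    exact intervalIntegral.integral_mono_on hs ((hcont P).intervalIntegrable _ _)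
      ((continuous_finsetSum _ fun Z _ => hcont (h Z)).intervalIntegrable _ _) fun r _ => hpt r
  -- Step 2: the closed system of integral inequalities for the `u_Z`
  let u : ι → ℝ → ℝ := fun Z r =>
    ‖heisenbergEvolution H r (h Z) * B - B * heisenbergEvolution H r (h Z)‖
  let K : ι → ι → ℝ := fun Z Z' => if touch Z' Z then 2 * ‖h Z‖ else 0
  let b : ι → ℝ := fun Z => ‖h Z * B - B * h Z‖
  let M : ι → ℝ := fun Z => 2 * ‖h Z‖ * ‖B‖
  set κ : ℝ := 2 * J * D with hκdef
  set β : ℝ := 2 * J * ‖B‖ with hβdef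
  have hκ0 : 0 ≤ κ := by positivity
  have hβ0 : 0 ≤ β := by positivity
  have hK : ∀ Z Z', 0 ≤ K Z Z' := fun Z Z' => by
    dsimp only [K]; split_ifs <;> positivity
  have hu : ∀ Z, Continuous (u Z) := fun Z => hcont (h Z)
  have hMb : ∀ Z, ∀ s ∈ Set.Icc 0 t, u Z s ≤ M Z := fun Z s _ =>
    norm_commutator_heisenbergEvolution_le_two_mul hH s (h Z) B
  have hineq : ∀ Z, ∀ s ∈ Set.Icc 0 t, u Z s ≤ b Z + ∑ Z', K Z Z' * ∫ r in (0 : ℝ)..s, u Z' r := by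
    intro Z s hs
    have hd := duhamel (h Z) (Finset.univ.filter fun Z' => touch Z' Z)
      (fun Z' hZ' => htouch Z Z' (by simpa using hZ')) s hs.1
    refine hd.trans (le_of_eq ?_)
    show b Z + 2 * ‖h Z‖ * ∑ Z' ∈ Finset.univ.filter (fun Z' => touch Z' Z),
        ∫ r in (0 : ℝ)..s, u Z' r = b Z + ∑ Z', K Z Z' * ∫ r in (0 : ℝ)..s, u Z' r
    rw [Finset.mul_sum, Finset.sum_filter]
    refine congrArg _ (Finset.sum_congr rfl fun Z' _ => ?_)
    dsimp only [K]
    split_ifs <;> simp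
  have hκ : ∀ Z, ∑ Z', K Z Z' ≤ κ := by
    intro Z
    dsimp only [K]
    rw [← Finset.sum_filter, Finset.sum_const, nsmul_eq_mul]
    calc ((Finset.univ.filter fun Z' => touch Z' Z).card : ℝ) * (2 * ‖h Z‖) ≤ D * (2 * J) :=
          mul_le_mul (by exact_mod_cast hD Z) (by linarith [hJ Z]) (by positivity) (by positivity)
      _ = κ := by rw [hκdef]; ring
  have hMβ : ∀ Z, M Z ≤ β := fun Z => by
    show 2 * ‖h Z‖ * ‖B‖ ≤ 2 * J * ‖B‖
    exact mul_le_mul_of_nonneg_right (by linarith [hJ Z]) (norm_nonneg _)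
  have hbβ : ∀ Z, b Z ≤ β := fun Z => (norm_commutator_le (h Z) B).trans (hMβ Z)
  -- Step 3: the Gronwall iteration
  have hG : ∀ (N : ℕ) (Z : ι), ∀ s ∈ Set.Icc 0 t, u Z s ≤ gronwallPoly K b M N Z s :=
    gronwall_iterate hK hu hMb hineq
  -- Step 4: the light cone and the exponential tail
  have hb0 : ∀ Z, ℓ Z ≠ 0 → b Z = 0 := fun Z hZ => by
    show ‖h Z * B - B * h Z‖ = 0
    rw [(hℓ0 Z hZ).eq, sub_self, norm_zero]
  have hK1 : ∀ Z Z', K Z Z' ≠ 0 → ℓ Z ≤ ℓ Z' + 1 := fun Z Z' hKZ => by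
    by_cases htZ : touch Z' Z
    · exact hℓ Z Z' htZ
    · exact absurd (by dsimp only [K]; rw [if_neg htZ]) hKZ
  have hpartial : ∀ (N : ℕ) (Z : ι),
      (∑ m ∈ Finset.range N, t ^ (m + 1) / (m + 1).factorial * iterKernel K b m Z) ≤
        β * t * (Real.exp (-ℓ Z) * Real.exp (Real.exp 1 * (κ * t))) := by
    intro N Z
    rw [← Finset.sum_filter_of_ne (p := fun m => ℓ Z ≤ m) (fun m _ hne => by
      by_contra hc
      exact hne (by rw [iterKernel_eq_zero_of_lt hb0 hK1 m Z (by omega), mul_zero]))]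
    have hterm : ∀ m : ℕ, t ^ (m + 1) / (m + 1).factorial * iterKernel K b m Z ≤
        β * t * ((κ * t) ^ m / m.factorial) := by
      intro m
      have h1 : t ^ (m + 1) / (m + 1).factorial * iterKernel K b m Z ≤
          t ^ (m + 1) / (m + 1).factorial * (κ ^ m * β) :=
        mul_le_mul_of_nonneg_left (iterKernel_le_pow hK hκ hβ0 hbβ m Z) (by positivity)
      refine h1.trans ?_
      have hf : (m.factorial : ℝ) ≤ (m + 1).factorial := by
        exact_mod_cast Nat.factorial_le (Nat.le_succ m)
      have hfpos : (0 : ℝ) < m.factorial := by positivity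
      have hc : 0 ≤ β * t * (κ ^ m * t ^ m) := by positivity
      calc t ^ (m + 1) / (m + 1).factorial * (κ ^ m * β)
          = β * t * (κ ^ m * t ^ m) / (m + 1).factorial := by rw [pow_succ]; ring
        _ ≤ β * t * (κ ^ m * t ^ m) / m.factorial := div_le_div_of_nonneg_left hc hfpos hf
        _ = β * t * ((κ * t) ^ m / m.factorial) := by rw [mul_pow κ t m]; ring
    calc (∑ m ∈ (Finset.range N).filter (fun m => ℓ Z ≤ m),
          t ^ (m + 1) / (m + 1).factorial * iterKernel K b m Z)
        ≤ ∑ m ∈ (Finset.range N).filter (fun m => ℓ Z ≤ m), β * t * ((κ * t) ^ m / m.factorial) :=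
          Finset.sum_le_sum fun m _ => hterm m
      _ = β * t * ∑ m ∈ (Finset.range N).filter (fun m => ℓ Z ≤ m), (κ * t) ^ m / m.factorial := by
          rw [Finset.mul_sum]
      _ ≤ β * t * (Real.exp (-ℓ Z) * Real.exp (Real.exp 1 * (κ * t))) :=
          mul_le_mul_of_nonneg_left (sum_range_filter_pow_div_factorial_le (by positivity) _ _)
            (by positivity)
  -- Step 5: the bound for `A`, for every truncation order `N`
  set F : ℝ := ‖A * B - B * A‖ + 2 * ‖A‖ * ∑ Z ∈ S,
    β * t * (Real.exp (-ℓ Z) * Real.exp (Real.exp 1 * (κ * t))) with hFdef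
  let R : ℕ → ℝ := fun N =>
    2 * ‖A‖ * (S.card * (t ^ (N + 1) / (N + 1).factorial * (κ ^ N * β)))
  have hbound : ∀ N : ℕ,
      ‖heisenbergEvolution H t A * B - B * heisenbergEvolution H t A‖ ≤ F + R N := by
    intro N
    refine (duhamel A S hS t ht).trans ?_
    have hint_le : ∀ Z ∈ S, ∫ r in (0 : ℝ)..t, u Z r ≤
        β * t * (Real.exp (-ℓ Z) * Real.exp (Real.exp 1 * (κ * t))) +
          t ^ (N + 1) / (N + 1).factorial * (κ ^ N * β) := by
      intro Z _
      calc ∫ r in (0 : ℝ)..t, u Z r ≤ ∫ r in (0 : ℝ)..t, gronwallPoly K b M N Z r :=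
            intervalIntegral.integral_mono_on ht ((hu Z).intervalIntegrable _ _)
              ((continuous_gronwallPoly K b M N Z).intervalIntegrable _ _) fun r hr => hG N Z r hr
        _ = (∑ m ∈ Finset.range N, t ^ (m + 1) / (m + 1).factorial * iterKernel K b m Z) +
              t ^ (N + 1) / (N + 1).factorial * iterKernel K M N Z := integral_gronwallPoly_eq K b M N Z t
        _ ≤ β * t * (Real.exp (-ℓ Z) * Real.exp (Real.exp 1 * (κ * t))) +
              t ^ (N + 1) / (N + 1).factorial * (κ ^ N * β) :=
            add_le_add (hpartial N Z) (mul_le_mul_of_nonneg_left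
              (iterKernel_le_pow hK hκ hβ0 hMβ N Z) (by positivity))
    show ‖A * B - B * A‖ + 2 * ‖A‖ * ∑ Z ∈ S, ∫ r in (0 : ℝ)..t, u Z r ≤ F + R N
    rw [hFdef]
    show _ ≤ ‖A * B - B * A‖ + 2 * ‖A‖ * ∑ Z ∈ S,
        β * t * (Real.exp (-ℓ Z) * Real.exp (Real.exp 1 * (κ * t))) +
      2 * ‖A‖ * (S.card * (t ^ (N + 1) / (N + 1).factorial * (κ ^ N * β)))
    rw [add_assoc, ← mul_add, ← nsmul_eq_mul, ← Finset.sum_const, ← Finset.sum_add_distrib]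
    exact add_le_add le_rfl (mul_le_mul_of_nonneg_left (Finset.sum_le_sum hint_le) (by positivity))
  -- Step 6: the remainder tends to zero
  have hR : Filter.Tendsto R Filter.atTop (nhds 0) := by
    have hmain := FloorSemiring.tendsto_pow_div_factorial_atTop (κ * t)
    have hR' : ∀ N, R N = (2 * ‖A‖ * (S.card * (t * β))) * ((κ * t) ^ N / N.factorial) *
        ((N.factorial : ℝ) / (N + 1).factorial) := by
      intro N
      have hf1 : ((N + 1).factorial : ℝ) ≠ 0 := by positivity
      have hf0 : (N.factorial : ℝ) ≠ 0 := by positivity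
      show 2 * ‖A‖ * (S.card * (t ^ (N + 1) / (N + 1).factorial * (κ ^ N * β))) = _
      field_simp
      ring
    have hratio : ∀ N : ℕ, ((N.factorial : ℝ) / (N + 1).factorial) ≤ 1 := fun N => by
      rw [div_le_one (by positivity)]
      exact_mod_cast Nat.factorial_le (Nat.le_succ N)
    have hRnn : ∀ N, 0 ≤ R N := fun N => by positivity
    refine squeeze_zero hRnn (fun N => ?_) ?_ (g := fun N =>
      (2 * ‖A‖ * (S.card * (t * β))) * ((κ * t) ^ N / N.factorial))
    · rw [hR' N]
      exact mul_le_of_le_one_right (by positivity) (hratio N)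
    · simpa using hmain.const_mul (2 * ‖A‖ * (S.card * (t * β)))
  have hlim : Filter.Tendsto (fun N => F + R N) Filter.atTop (nhds (F + 0)) :=
    tendsto_const_nhds.add hR
  rw [add_zero] at hlim
  have hfinal : ‖heisenbergEvolution H t A * B - B * heisenbergEvolution H t A‖ ≤ F :=
    ge_of_tendsto' hlim hbound
  -- cosmetics
  refine hfinal.trans (le_of_eq ?_)
  rw [hFdef]
  congr 1
  refine congrArg _ (Finset.sum_congr rfl fun Z _ => ?_)
  rw [hβdef, hκdef, sub_eq_add_neg, Real.exp_add]
  ring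

end AbstractLR


/-! ### Lattice fermions: the Lieb–Robinson bound for the Hubbard Hamiltonian on a finite graph -/

section FermionHubbard

variable {Λ : Type*} [LinearOrder Λ] [Fintype Λ]

/-- The orbitals `(x, σ)` over a set of sites `X`. [folklore] -/
def orbSet (X : Finset Λ) : Finset (Orb Λ) := Finset.univ.filter fun k => (ofLex k).1 ∈ X

/-- Membership in `orbSet`. [folklore] -/
theorem mem_orbSet {X : Finset Λ} {k : Orb Λ} : k ∈ orbSet X ↔ (ofLex k).1 ∈ X := by
  simp [orbSet]

/-- `(x, σ) ∈ orbSet X` for `x ∈ X`. [folklore] -/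
theorem orb_mem_orbSet {X : Finset Λ} {x : Λ} (hx : x ∈ X) (σ : Fin 2) : orb x σ ∈ orbSet X :=
  mem_orbSet.2 hx

/-- Disjoint site sets carry disjoint orbital sets. [folklore] -/
theorem disjoint_orbSet {X Y : Finset Λ} (h : Disjoint X Y) : Disjoint (orbSet X) (orbSet Y) := by
  rw [Finset.disjoint_left] at h ⊢
  intro k hkX hkY
  exact h (mem_orbSet.1 hkX) (mem_orbSet.1 hkY)

variable (G : SimpleGraph Λ) [DecidableRel G.Adj]

/-- The index set of the local terms of the Hubbard Hamiltonian on the graph `G`: ordered bonds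
(adjacent pairs) and sites. [folklore] -/
abbrev HubbardIdx : Type _ := {p : Λ × Λ // G.Adj p.1 p.2} ⊕ Λ

/-- The local terms of `H(t,U) - μN`: the symmetrised hopping `-(t/2) Σ_σ (c†_{xσ}c_{yσ} + c†_{yσ}c_{xσ})`
on an ordered bond `(x, y)` (each bond thus appears twice) and the on-site term
`U n_{x↑}n_{x↓} - μ (n_{x↑} + n_{x↓})`. [folklore] -/
def hubbardTermOp (t U μ : ℝ) : HubbardIdx G → Matrix (Finset (Orb Λ)) (Finset (Orb Λ)) ℂ
  | Sum.inl p => (-((t / 2 : ℝ) : ℂ)) • ∑ σ : Fin 2,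
      (creation (orb p.1.1 σ) * annihilation (orb p.1.2 σ) +
        creation (orb p.1.2 σ) * annihilation (orb p.1.1 σ))
  | Sum.inr x => (U : ℂ) • (numberOp x 0 * numberOp x 1) - (μ : ℂ) • (numberOp x 0 + numberOp x 1)

/-- The sites carrying a local term. [folklore] -/
def hubbardTermSupp : HubbardIdx G → Finset Λ
  | Sum.inl p => {p.1.1, p.1.2}
  | Sum.inr x => {x}

/-- **The Hubbard Hamiltonian is the sum of its local terms.** [folklore] -/
theorem sum_hubbardTermOp (t U μ : ℝ) :
    ∑ Z, hubbardTermOp G t U μ Z = hamiltonianWith G t U μ := by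
  rw [Fintype.sum_sum_type]
  -- the hopping part
  have hbond : ∑ p : {p : Λ × Λ // G.Adj p.1 p.2}, hubbardTermOp G t U μ (Sum.inl p) =
      -(t : ℂ) • ∑ x : Λ, ∑ y : Λ, ∑ σ : Fin 2,
        if G.Adj x y then creation (orb x σ) * annihilation (orb y σ) else 0 := by
    have hT : ∀ f : Λ × Λ → Matrix (Finset (Orb Λ)) (Finset (Orb Λ)) ℂ,
        ∑ p : {p : Λ × Λ // G.Adj p.1 p.2}, f p.1 =
          ∑ x : Λ, ∑ y : Λ, if G.Adj x y then f (x, y) else 0 := by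
      intro f
      rw [← Finset.sum_subtype (Finset.univ.filter fun p : Λ × Λ => G.Adj p.1 p.2)
        (p := fun p : Λ × Λ => G.Adj p.1 p.2) (fun p => by simp), Finset.sum_filter,
        ← Finset.univ_product_univ, Finset.sum_product]
    simp only [hubbardTermOp]
    rw [hT (fun p => (-((t / 2 : ℝ) : ℂ)) • ∑ σ : Fin 2,
      (creation (orb p.1 σ) * annihilation (orb p.2 σ) + creation (orb p.2 σ) * annihilation (orb p.1 σ)))]
    have hsplit : ∀ x y : Λ, (if G.Adj x y then (-((t / 2 : ℝ) : ℂ)) • ∑ σ : Fin 2,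
        (creation (orb x σ) * annihilation (orb y σ) + creation (orb y σ) * annihilation (orb x σ))
        else 0) =
        (-((t / 2 : ℝ) : ℂ)) • (∑ σ : Fin 2,
          if G.Adj x y then creation (orb x σ) * annihilation (orb y σ) else 0) +
        (-((t / 2 : ℝ) : ℂ)) • (∑ σ : Fin 2,
          if G.Adj x y then creation (orb y σ) * annihilation (orb x σ) else 0) := by
      intro x y
      split_ifs with h
      · rw [← smul_add, ← Finset.sum_add_distrib]
      · simp
    simp_rw [hsplit, Finset.sum_add_distrib, ← Finset.smul_sum]
    have hswap : (∑ x : Λ, ∑ y : Λ, ∑ σ : Fin 2,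
        if G.Adj x y then creation (orb y σ) * annihilation (orb x σ) else 0) =
        ∑ x : Λ, ∑ y : Λ, ∑ σ : Fin 2,
          if G.Adj x y then creation (orb x σ) * annihilation (orb y σ) else 0 := by
      rw [Finset.sum_comm]
      refine Finset.sum_congr rfl fun x _ => Finset.sum_congr rfl fun y _ =>
        Finset.sum_congr rfl fun σ _ => ?_
      simp only [G.adj_comm x y]
    rw [hswap, ← add_smul]
    congr 1
    push_cast
    ring
  -- the on-site part
  have hsite : ∑ x : Λ, hubbardTermOp G t U μ (Sum.inr x) =
      (U : ℂ) • (∑ x : Λ, numberOp x 0 * numberOp x 1) - (μ : ℂ) • totalNumber := by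
    simp only [hubbardTermOp, Finset.sum_sub_distrib, ← Finset.smul_sum]
    congr 2
    unfold totalNumber
    refine Finset.sum_congr rfl fun x _ => ?_
    rw [Fin.sum_univ_two]
  rw [hbond, hsite, hamiltonianWith, hamiltonian]
  abel

omit [DecidableRel G.Adj] in
/-- The local terms are Hermitian. [folklore] -/
theorem isHermitian_hubbardTermOp (t U μ : ℝ) (Z : HubbardIdx G) :
    (hubbardTermOp G t U μ Z).IsHermitian := by
  have hn : ∀ (x : Λ) (σ : Fin 2), (numberOp x σ : Matrix (Finset (Orb Λ)) (Finset (Orb Λ)) ℂ)ᴴ =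
      numberOp x σ := fun x σ => (numberAt_isHermitian (orb x σ)).eq
  cases Z with
  | inl p =>
    unfold hubbardTermOp IsHermitian
    rw [conjTranspose_smul, conjTranspose_sum]
    have hstar : star (-((t / 2 : ℝ) : ℂ)) = -((t / 2 : ℝ) : ℂ) := by
      simp only [star_neg, Complex.star_def, Complex.conj_ofReal]
    rw [hstar]
    congr 1
    refine Finset.sum_congr rfl fun σ _ => ?_
    rw [conjTranspose_add, conjTranspose_mul, conjTranspose_mul, creation_conjTranspose,
      creation_conjTranspose, annihilation_conjTranspose, annihilation_conjTranspose, add_comm]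
  | inr x =>
    unfold hubbardTermOp IsHermitian
    have hc : (numberOp x 1 : Matrix (Finset (Orb Λ)) (Finset (Orb Λ)) ℂ) * numberOp x 0 =
        numberOp x 0 * numberOp x 1 := (numberAt_commute (orb x 1) (orb x 0)).eq
    simp only [conjTranspose_sub, conjTranspose_smul, conjTranspose_mul, conjTranspose_add, hn, hc,
      Complex.star_def, Complex.conj_ofReal]

omit [DecidableRel G.Adj] in
/-- The local terms are even elements of the CAR algebra of their sites. [folklore] -/
theorem hubbardTermOp_mem_carEvenSubalgebra (t U μ : ℝ) (Z : HubbardIdx G) :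
    hubbardTermOp G t U μ Z ∈ carEvenSubalgebra (orbSet (hubbardTermSupp G Z)) := by
  cases Z with
  | inl p =>
    unfold hubbardTermOp
    refine Subalgebra.smul_mem _ (Subalgebra.sum_mem _ fun σ _ => Subalgebra.add_mem _ ?_ ?_) _
    · exact creation_mul_annihilation_mem_carEvenSubalgebra
        (orb_mem_orbSet (by simp [hubbardTermSupp]) σ) (orb_mem_orbSet (by simp [hubbardTermSupp]) σ)
    · exact creation_mul_annihilation_mem_carEvenSubalgebra
        (orb_mem_orbSet (by simp [hubbardTermSupp]) σ) (orb_mem_orbSet (by simp [hubbardTermSupp]) σ)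
  | inr x =>
    unfold hubbardTermOp
    have hn : ∀ σ : Fin 2, (numberOp x σ : Matrix (Finset (Orb Λ)) (Finset (Orb Λ)) ℂ) ∈
        carEvenSubalgebra (orbSet (hubbardTermSupp G (Sum.inr x))) := fun σ =>
      creation_mul_annihilation_mem_carEvenSubalgebra
        (orb_mem_orbSet (by simp [hubbardTermSupp]) σ) (orb_mem_orbSet (by simp [hubbardTermSupp]) σ)
    exact Subalgebra.sub_mem _ (Subalgebra.smul_mem _ (Subalgebra.mul_mem _ (hn 0) (hn 1)) _)
      (Subalgebra.smul_mem _ (Subalgebra.add_mem _ (hn 0) (hn 1)) _)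

/-- `‖n_{xσ}‖ ≤ 1`. [folklore] -/
theorem norm_numberOp_le_one (x : Λ) (σ : Fin 2) :
    ‖(numberOp x σ : Matrix (Finset (Orb Λ)) (Finset (Orb Λ)) ℂ)‖ ≤ 1 :=
  (norm_mul_le _ _).trans (mul_le_one₀ (norm_creation_le_one _) (norm_nonneg _)
    (norm_annihilation_le_one _))

omit [DecidableRel G.Adj] in
/-- Norm bound of the local terms: `‖h_Z‖ ≤ 2|t| + |U| + 2|μ|`. [folklore] -/
theorem norm_hubbardTermOp_le (t U μ : ℝ) (Z : HubbardIdx G) :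
    ‖hubbardTermOp G t U μ Z‖ ≤ 2 * |t| + |U| + 2 * |μ| := by
  have hcc : ∀ i j : Orb Λ, ‖(creation i * annihilation j : Matrix (Finset (Orb Λ)) (Finset (Orb Λ)) ℂ)‖ ≤ 1 :=
    fun i j => (norm_mul_le _ _).trans (mul_le_one₀ (norm_creation_le_one _) (norm_nonneg _)
      (norm_annihilation_le_one _))
  cases Z with
  | inl p =>
    unfold hubbardTermOp
    calc ‖(-((t / 2 : ℝ) : ℂ)) • ∑ σ : Fin 2, (creation (orb p.1.1 σ) * annihilation (orb p.1.2 σ) +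
            creation (orb p.1.2 σ) * annihilation (orb p.1.1 σ))‖
        ≤ ‖(-((t / 2 : ℝ) : ℂ))‖ * ∑ σ : Fin 2, ‖(creation (orb p.1.1 σ) * annihilation (orb p.1.2 σ) +
            creation (orb p.1.2 σ) * annihilation (orb p.1.1 σ) :
              Matrix (Finset (Orb Λ)) (Finset (Orb Λ)) ℂ)‖ := by
          rw [norm_smul]
          exact mul_le_mul_of_nonneg_left (norm_sum_le _ _) (norm_nonneg _)
      _ ≤ |t| / 2 * ∑ _σ : Fin 2, (2 : ℝ) := by
          rw [norm_neg, Complex.norm_real, Real.norm_eq_abs, abs_div, abs_two]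
          refine mul_le_mul_of_nonneg_left (Finset.sum_le_sum fun σ _ => ?_) (by positivity)
          have h1 := hcc (orb p.1.1 σ) (orb p.1.2 σ)
          have h2 := hcc (orb p.1.2 σ) (orb p.1.1 σ)
          exact (norm_add_le _ _).trans (by linarith)
      _ = 2 * |t| := by rw [Finset.sum_const, Finset.card_univ, Fintype.card_fin]; ring
      _ ≤ 2 * |t| + |U| + 2 * |μ| := by linarith [abs_nonneg U, abs_nonneg μ]
  | inr x =>
    unfold hubbardTermOp
    have h1 : ‖(U : ℂ) • ((numberOp x 0 : Matrix (Finset (Orb Λ)) (Finset (Orb Λ)) ℂ) * numberOp x 1)‖ ≤ |U| := by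
      rw [norm_smul, Complex.norm_real, Real.norm_eq_abs]
      exact mul_le_of_le_one_right (abs_nonneg _) ((norm_mul_le _ _).trans
        (mul_le_one₀ (norm_numberOp_le_one x 0) (norm_nonneg _) (norm_numberOp_le_one x 1)))
    have h2 : ‖(μ : ℂ) • ((numberOp x 0 : Matrix (Finset (Orb Λ)) (Finset (Orb Λ)) ℂ) + numberOp x 1)‖ ≤ 2 * |μ| := by
      rw [norm_smul, Complex.norm_real, Real.norm_eq_abs]
      calc |μ| * ‖(numberOp x 0 : Matrix (Finset (Orb Λ)) (Finset (Orb Λ)) ℂ) + numberOp x 1‖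
          ≤ |μ| * (1 + 1) := mul_le_mul_of_nonneg_left ((norm_add_le _ _).trans
              (add_le_add (norm_numberOp_le_one x 0) (norm_numberOp_le_one x 1))) (abs_nonneg _)
        _ = 2 * |μ| := by ring
    calc _ ≤ ‖(U : ℂ) • ((numberOp x 0 : Matrix (Finset (Orb Λ)) (Finset (Orb Λ)) ℂ) * numberOp x 1)‖ +
          ‖(μ : ℂ) • ((numberOp x 0 : Matrix (Finset (Orb Λ)) (Finset (Orb Λ)) ℂ) + numberOp x 1)‖ :=
          norm_sub_le _ _
      _ ≤ |U| + 2 * |μ| := add_le_add h1 h2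
      _ ≤ 2 * |t| + |U| + 2 * |μ| := by linarith [abs_nonneg t]

omit [DecidableRel G.Adj] in
/-- **Graded locality of the Hubbard terms**: a local term commutes with every element of the CAR
algebra of a disjoint set of sites (the terms are even). [folklore] -/
theorem commute_hubbardTermOp_of_disjoint (t U μ : ℝ) (Z : HubbardIdx G) {X : Finset Λ}
    {A : Matrix (Finset (Orb Λ)) (Finset (Orb Λ)) ℂ} (hA : A ∈ carSubalgebra (orbSet X))
    (hdisj : Disjoint (hubbardTermSupp G Z) X) : Commute (hubbardTermOp G t U μ Z) A :=
  commute_of_mem_carEvenSubalgebra (hubbardTermOp_mem_carEvenSubalgebra G t U μ Z) hA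
    (disjoint_orbSet hdisj)

omit [Fintype Λ] [DecidableRel G.Adj] in
/-- Every site of a term is the whole support or adjacent to the rest of it: for `z, w` in the
support of one term, `z = w` or `z ∼ w`. [folklore] -/
theorem eq_or_adj_of_mem_hubbardTermSupp {Z : HubbardIdx G} {z w : Λ}
    (hz : z ∈ hubbardTermSupp G Z) (hw : w ∈ hubbardTermSupp G Z) : z = w ∨ G.Adj z w := by
  cases Z with
  | inl p =>
    simp only [hubbardTermSupp, Finset.mem_insert, Finset.mem_singleton] at hz hw
    rcases hz with rfl | rfl <;> rcases hw with rfl | rfl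
    · exact Or.inl rfl
    · exact Or.inr p.2
    · exact Or.inr (G.adj_symm p.2)
    · exact Or.inl rfl
  | inr x =>
    simp only [hubbardTermSupp, Finset.mem_singleton] at hz hw
    exact Or.inl (hz.trans hw.symm)

omit [Fintype Λ] [DecidableRel G.Adj] in
/-- The support of a term is nonempty. [folklore] -/
theorem hubbardTermSupp_nonempty (Z : HubbardIdx G) : (hubbardTermSupp G Z).Nonempty := by
  cases Z with
  | inl p => exact ⟨p.1.1, by simp [hubbardTermSupp]⟩
  | inr x => exact ⟨x, by simp [hubbardTermSupp]⟩

/-- The number of terms whose support meets a given set of at most two... (general): the terms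
meeting a set `W` of sites number at most `|W| (2Δ + 1)` when every site has at most `Δ`
neighbours. [folklore] -/
theorem card_filter_not_disjoint_hubbardTermSupp_le {Δ : ℕ}
    (hΔ : ∀ x : Λ, (Finset.univ.filter fun y => G.Adj x y).card ≤ Δ) (W : Finset Λ) :
    (Finset.univ.filter fun Z : HubbardIdx G => ¬ Disjoint (hubbardTermSupp G Z) W).card ≤
      W.card * (2 * Δ + 1) := by
  classical
  -- cover by explicit images
  let f₁ : Λ × Λ → HubbardIdx G := fun q =>
    if h : G.Adj q.1 q.2 then Sum.inl ⟨q, h⟩ else Sum.inr q.1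
  let f₂ : Λ × Λ → HubbardIdx G := fun q =>
    if h : G.Adj q.2 q.1 then Sum.inl ⟨(q.2, q.1), h⟩ else Sum.inr q.1
  let E : Finset (Λ × Λ) := W.biUnion fun w => (Finset.univ.filter fun y => G.Adj w y).image fun y => (w, y)
  have hE : E.card ≤ W.card * Δ := by
    refine (Finset.card_biUnion_le).trans ?_
    calc ∑ w ∈ W, ((Finset.univ.filter fun y => G.Adj w y).image fun y => (w, y)).card
        ≤ ∑ _w ∈ W, Δ := Finset.sum_le_sum fun w _ => Finset.card_image_le.trans (hΔ w)
      _ = W.card * Δ := by rw [Finset.sum_const, smul_eq_mul]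
  have hsub : (Finset.univ.filter fun Z : HubbardIdx G => ¬ Disjoint (hubbardTermSupp G Z) W) ⊆
      E.image f₁ ∪ E.image f₂ ∪ W.image Sum.inr := by
    intro Z hZ
    rw [Finset.mem_filter] at hZ
    obtain ⟨w, hwZ, hwW⟩ := Finset.not_disjoint_iff.1 hZ.2
    cases Z with
    | inr x =>
      simp only [hubbardTermSupp, Finset.mem_singleton] at hwZ
      subst hwZ
      exact Finset.mem_union_right _ (Finset.mem_image_of_mem _ hwW)
    | inl p =>
      simp only [hubbardTermSupp, Finset.mem_insert, Finset.mem_singleton] at hwZ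
      rcases hwZ with rfl | rfl
      · refine Finset.mem_union_left _ (Finset.mem_union_left _ (Finset.mem_image.2 ⟨p.1, ?_, ?_⟩))
        · exact Finset.mem_biUnion.2 ⟨p.1.1, hwW, Finset.mem_image.2 ⟨p.1.2, by simp [p.2], rfl⟩⟩
        · simp [f₁, p.2]
      · refine Finset.mem_union_left _ (Finset.mem_union_right _ (Finset.mem_image.2 ⟨(p.1.2, p.1.1), ?_, ?_⟩))
        · exact Finset.mem_biUnion.2 ⟨p.1.2, hwW, Finset.mem_image.2 ⟨p.1.1, by simp [G.adj_symm p.2], rfl⟩⟩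
        · simp [f₂, p.2]
  calc (Finset.univ.filter fun Z : HubbardIdx G => ¬ Disjoint (hubbardTermSupp G Z) W).card
      ≤ (E.image f₁ ∪ E.image f₂ ∪ W.image Sum.inr).card := Finset.card_le_card hsub
    _ ≤ (E.image f₁).card + (E.image f₂).card + (W.image (Sum.inr : Λ → HubbardIdx G)).card :=
        (Finset.card_union_le _ _).trans (add_le_add (Finset.card_union_le _ _) le_rfl)
    _ ≤ W.card * Δ + W.card * Δ + W.card :=
        add_le_add (add_le_add (Finset.card_image_le.trans hE) (Finset.card_image_le.trans hE))
          Finset.card_image_le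
    _ = W.card * (2 * Δ + 1) := by ring

/-- **Lieb–Robinson bound for the Hubbard model on a finite graph (lattice fermions).**
Let `G` have maximal degree `≤ Δ`, let `A` lie in the CAR algebra of the sites `X` and `B` in that
of the sites `Y` (no parity restriction: the Hamiltonian is even), and let `δ : Λ → ℕ` be any
function vanishing on `Y` and changing by at most one across an edge (e.g. the graph distance to
`Y`). Then for `s ≥ 0`, with `J = 2|t| + |U| + 2|μ|` and `D = 2(2Δ + 1)`,
`‖[τ_s(A), B]‖ ≤ ‖[A, B]‖ + 2‖A‖ Σ_{Z : supp Z ∩ X ≠ ∅} 2J‖B‖ s e^{2eJD s - ℓ(Z)}`,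
`ℓ(Z) = min_{z ∈ supp Z} δ(z) ≥ min_X δ - 1`, the sum running over the `≤ |X|(2Δ+1)` local terms
meeting `X`: the abstract bound `lieb_robinson_abstract` for the even finite-range interaction
`hubbardTermOp`, with graded locality from `commute_of_mem_carEvenSubalgebra`. Hastings–Koma,
CMP 265 (2006) 781, App. A (Lieb–Robinson bounds "for quantum spin or fermion systems");
Bratteli–Robinson II §5.2.2 (even elements of disjoint regions commute).
[cite: HastingsKoma2006, App. A] -/
theorem fermion_lieb_robinson_hamiltonianWith {Δ : ℕ}
    (hΔ : ∀ x : Λ, (Finset.univ.filter fun y => G.Adj x y).card ≤ Δ) (t U μ : ℝ)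
    {X Y : Finset Λ} {A B : Matrix (Finset (Orb Λ)) (Finset (Orb Λ)) ℂ}
    (hA : A ∈ carSubalgebra (orbSet X)) (hB : B ∈ carSubalgebra (orbSet Y))
    (δ : Λ → ℕ) (hδY : ∀ y ∈ Y, δ y = 0) (hδ : ∀ x y, G.Adj x y → δ x ≤ δ y + 1)
    {s : ℝ} (hs : 0 ≤ s) :
    ‖heisenbergEvolution (hamiltonianWith G t U μ) s A * B - B * heisenbergEvolution (hamiltonianWith G t U μ) s A‖ ≤
      ‖A * B - B * A‖ + 2 * ‖A‖ *
        ∑ Z ∈ Finset.univ.filter (fun Z : HubbardIdx G => ¬ Disjoint (hubbardTermSupp G Z) X),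
          2 * (2 * |t| + |U| + 2 * |μ|) * ‖B‖ * s *
            Real.exp (Real.exp 1 * (2 * (2 * |t| + |U| + 2 * |μ|) * (2 * (2 * Δ + 1) : ℕ)) * s -
              ((hubbardTermSupp G Z).inf' (hubbardTermSupp_nonempty G Z) δ : ℕ)) := by
  classical
  rw [← sum_hubbardTermOp G t U μ]
  refine lieb_robinson_abstract (hubbardTermOp G t U μ) (isHermitian_hubbardTermOp G t U μ)
    (fun Z' Z => ¬ Disjoint (hubbardTermSupp G Z') (hubbardTermSupp G Z)) ?_
    (by positivity) (norm_hubbardTermOp_le G t U μ) ?_ B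
    (fun Z => (hubbardTermSupp G Z).inf' (hubbardTermSupp_nonempty G Z) δ) ?_ ?_ A _ ?_ hs
  · -- non-touching terms commute
    intro Z Z' hZZ'
    rw [not_not] at hZZ'
    exact commute_hubbardTermOp_of_disjoint G t U μ Z'
      ((carEvenSubalgebra_le_carSubalgebra _) (hubbardTermOp_mem_carEvenSubalgebra G t U μ Z)) hZZ'
  · -- at most `2(2Δ+1)` terms touch a given term
    intro Z
    refine (card_filter_not_disjoint_hubbardTermSupp_le G hΔ _).trans ?_
    have hcard : (hubbardTermSupp G Z).card ≤ 2 := by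
      cases Z with
      | inl p => exact Finset.card_insert_le _ _ |>.trans (by simp)
      | inr x => simp [hubbardTermSupp]
    calc (hubbardTermSupp G Z).card * (2 * Δ + 1) ≤ 2 * (2 * Δ + 1) := Nat.mul_le_mul_right _ hcard
      _ = (2 * (2 * Δ + 1) : ℕ) := rfl
  · -- terms at positive level do not meet `Y`, hence commute with `B`
    intro Z hZ
    refine commute_hubbardTermOp_of_disjoint G t U μ Z hB (Finset.disjoint_left.2 fun z hzZ hzY => hZ ?_)
    exact Nat.eq_zero_of_le_zero ((Finset.inf'_le δ hzZ).trans (hδY z hzY).le)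
  · -- the level drops by at most one along touching terms
    intro Z Z' hZZ'
    obtain ⟨w, hwZ', hwZ⟩ := Finset.not_disjoint_iff.1 hZZ'
    obtain ⟨z', hz', hmin⟩ := Finset.exists_mem_eq_inf' (hubbardTermSupp_nonempty G Z') δ
    rw [hmin]
    refine (Finset.inf'_le δ hwZ).trans ?_
    rcases eq_or_adj_of_mem_hubbardTermSupp G hwZ' hz' with h | h
    · rw [h]; exact Nat.le_succ _
    · exact hδ w z' h
  · -- terms not meeting `X` commute with `A`
    intro Z hZ
    rw [Finset.mem_filter, not_and, not_not] at hZ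
    exact commute_hubbardTermOp_of_disjoint G t U μ Z hA (hZ (Finset.mem_univ _))

end FermionHubbard

end Literature.MathematicalPhysics.QuantumLattice

end
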